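import Mathlib
import HarnessLib
import HarnessLib.Audit
import Summits.KontsevichZagierPeriods.Statement
import Literature.NumberTheory.Transcendental.PureNaivePeriodMap

/-!
Route: MotivatedMoves

DORMANT since 2026-09-04T09:11:00Z (reconciler: no traction for 5 d (last activity item-evidence-added at 2026-08-30T08:26:47Z); parked, not closed — `ledger route dormant route-KontsevichZagierPeriods-MotivatedMoves --off` to reactivat) — unstaffed, not closed; items shared with open routes are served there. `ledger route dormant <id> --off` reactivates.

# Route MotivatedMoves — Lefschetz inversion is free in FormalRep ⧸ relations, so motivated cycles
act by moves; André then hands over the abelian (Γ-monomial, CM, Weil, K3) sector unconditionally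

It suffices to show X = GammaHodgeSector ∧ CompleteModGammaSector (rev 2, 2026-08-16: the complement
of the sector is an honest, last-ranked crux of this route, so the route decides the whole of
Conjecture 1). (i) THE Γ-HODGE SECTOR (crux GammaHodgeSector, rank 2; divisor range GammaHodgePairs,
rank 4): every Deligne–Koblitz–Ogus relation Π B(x_j,y_j) = c·π^k·Π B(x'_l,y'_l) of Hodge type,
written between the cube representation and the (2k-ball × cube) representation, is a KZ
equivalence. (ii) CONJECTURE 1 FOR THE Γ-ENLARGED CALCULUS (crux CompleteModGammaSector, rank 6
here, conjecture-grade, summit-implied; ONE item shared with route TerasomaMultiplication —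
stmt-KontsevichZagierPeriods-14233, staffed once): every additive subgroup H ≥ KZ.relations that
contains the pair differences of (i) contains [r] − [r′] for all rational r, r′ of equal value —
equivalently `ker KZ.eval ≤ KZ.relations ⊔ closure{Γ-Hodge pair differences}` (kernel form; both
directions kernel-checked in planner Sketch2.lean).
The route's MECHANISM bears on (i) (card lefschetz-inversion-is-free, X₁ and X₂). MotivatedTransfer
(informal crux, rank 3; RESTATED rev 5, 2026-08-16, on AFFINE HOMOTOPY MODELS after the refuter's
frame/normalisation objection to stmt-3891): for the canonical pure naive period map Φ — a
PureNaivePeriodMap (the notion LANDED: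
Literature/NumberTheory/Transcendental/PureNaivePeriodMap.lean) over a number field K ⊂ ℂ that is
pullback-normalised and satisfies Stokes, whose EXISTENCE is the typed construction crux
NaivePeriodMapExists (rank 7, with support CanonicalNaiveRep) — evaluated on Jouanolou affine models
X̃ = V(I) → X of smooth projective X (closed polynomial forms for de Rham classes of every degree,
closed admissible cubical cycles in X̃(ℂ) for Betti classes), every period identity induced by a
MOTIVATED correspondence in André's sense lies in `KZ.relations₂` (pairs: real and imaginary parts):
algebraic classes act by Gysin/restriction chains and sheet transfer, exact algebraic forms
integrate to relations, Künneth is the product of `KZProductIdeal`, (2πi)^s acts as 2^s·J^s(s!·[unit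
2s-ball] × ·) with J(a,b) = (−b,a), and the Lefschetz inverse Λ COSTS NOTHING because `FormalRep ⧸
relations` is a commutative ring in which the K-matrix of L^(n−i) is invertible (typed supports
LefschetzInversionFree, ConstantMatrixUnit) — no Standard Conjecture B, no Hodge conjecture.
AbelianHodgeDividend (informal SUPPORT since rev 8 — crux rank 5 before; re-badged on refuter
rattack-3892-0's findings: the auto-crux flag was a false positive and the item is near-glue over
MotivatedTransfer and theorems in print): with André 1996 Thm 0.6.2 (Hodge classes on abelian
varieties are motivated; a theorem in print, the tree's B-parametrised predicate
`Literature.Barriers.HodgeConjecture.Andre1996_hodgeClassesOnAbelianVarieties_motivated`) every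
Hodge-class period relation of abelian type is a KZ relation; GammaHodgeSector is its sharpest
decidable-hypothesis instance and the route's TYPED deliverable. Crux (ii) is
Grothendieck-period-conjecture strength off the abelian sector (mixed Tate/MZV, non-CM elliptic,
exponential detours): this route owns it, leaves it whole, and expects movement on it from the
kernel-form routes of the summit (NoriTransfer, Grothendieck, KatzTower, OctahedralSymmetry,
SpectrahedralScissors — each of their summit-level cruxes implies it outright) and from its standing
disprover.
Lean (typed sector deliverable = item GammaHodgeSector; elaborates, planner Sketch.lean rc 0): `∀ (N
N' k : ℕ) (x y : Fin N → ℚ) (x' y' : Fin N' → ℚ) (c : ℝ), (∀ j, 0 < x j ∧ 0 < y j ∧ Int.fract (x j)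
≠ 0 ∧ Int.fract (y j) ≠ 0) → (∀ l, 0 < x' l ∧ 0 < y' l ∧ Int.fract (x' l) ≠ 0 ∧ Int.fract (y' l) ≠
0) → (∀ u : ℕ, 0 < u → (∀ j, Nat.Coprime u (x j).den ∧ Nat.Coprime u (y j).den) → (∀ l, Nat.Coprime
u (x' l).den ∧ Nat.Coprime u (y' l).den) → ((∑ j, (Int.fract ((u : ℚ) * x j) + Int.fract ((u : ℚ) *
y j) - Int.fract ((u : ℚ) * (x j + y j)))) - ∑ l, (Int.fract ((u : ℚ) * x' l) + Int.fract ((u : ℚ) *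
y' l) - Int.fract ((u : ℚ) * (x' l + y' l)))) = (k : ℚ)) → IsAlgebraic ℚ c → ∀ (r :
Literature.NumberTheory.Transcendental.KZ.IntegralRep N) (r' :
Literature.NumberTheory.Transcendental.KZ.IntegralRep (2 * k + N')), r.domain = {t | ∀ j, t j ∈
Set.Ioo (0:ℝ) 1} → Set.EqOn r.integrand (fun t => ∏ j, (t j) ^ ((x j : ℝ) - 1) * (1 - t j) ^ ((y j :
ℝ) - 1)) r.domain → r'.domain = {z | (∑ i : Fin (2 * k), (z (Fin.castAdd N' i)) ^ 2) < 1 ∧ ∀ l : Fin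
N', z (Fin.natAdd (2 * k) l) ∈ Set.Ioo (0:ℝ) 1} → Set.EqOn r'.integrand (fun z => c * (k.factorial :
ℝ) * ∏ l, (z (Fin.natAdd (2 * k) l)) ^ ((x' l : ℝ) - 1) * (1 - z (Fin.natAdd (2 * k) l)) ^ ((y' l :
ℝ) - 1)) r'.domain → r.value = r'.value → Literature.NumberTheory.Transcendental.KZ.Equivalent r r'`
Lean (crux (ii) = item CompleteModGammaSector, verbatim stmt-14233; elaborates, planner Sketch2.lean
rc 0): `∀ H : AddSubgroup KZ.FormalRep, KZ.relations ≤ H → (∀ Γ-Hodge pair (ρ, ρ′) with exactly the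
hypotheses of GammaHodgeSector and ρ.value = ρ′.value, KZ.of ρ − KZ.of ρ′ ∈ H) → ∀ ⦃n m⦄ r r′,
r.IsRational → r′.IsRational → r.value = r′.value → KZ.of r − KZ.of r′ ∈ H` (full term in the item).

## Assembly
Deciding theorem (rev 3, D-0027 §2.1; unchanged by rev 5): `theorem closes (h₁ : GammaHodgeSector)
(h₂ : CompleteModGammaSector) : KontsevichZagierPeriods` — for rational r, r′ with equal value take
H = KZ.relations in h₂: `relations ≤ relations` is le_rfl and the Γ-pair clause is h₁ verbatim
(KZ.Equivalent ρ ρ′ unfolds to [ρ] − [ρ′] ∈ relations), so `closes` is a three-line λ-term (planner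
Sketch2.lean rc 0, axioms propext/choice/Quot.sound); Assembly := GammaHodgeSector →
CompleteModGammaSector → KontsevichZagierPeriods. History of the second conjunct: rev 1 used the
sup/closure form GammaSectorComplete (stmt-10378, shared with TerasomaMultiplication, now moot); rev
2 (route-choice (a)) filed the kernel form CompleteModGammaSector (stmt-14267); minutes earlier
TerasomaMultiplication had filed the equivalent SUBGROUP form (stmt-14233), so rev 3 converges on
that item — one complement crux for the Γ-frame, staffed once. All three forms are equivalent and
summit-implied (Sketch.lean / Sketch2.lean rc 0, via KZ.exists_integralRep_sub,
relations_le_ker_eval, exists_isRational_equivalent of KZKernelConjectureForms). `GammaHodgeSector →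
GammaHodgePairs` holds by specialisation (sketch at open).
The MATHEMATICAL assembly of the sector is NaivePeriodMapExists ∧ MotivatedTransfer → (André 0.6.2)
→ AbelianHodgeDividend ⊇ GammaHodgeSector ⊇ GammaHodgePairs. Rev 5 (route-repair 2026-08-16): the
notion PureNaivePeriodMap has LANDED; MotivatedTransfer is restated on affine homotopy models over
it (Jouanolou torsors, every cohomological degree presentable; (2πi)^s ↦ 2^s·J^s(s!·[B^{2s}] × ·)),
its vacuity guard is the new typed crux NaivePeriodMapExists (∃ pullback-normalised Stokes period
map; support CanonicalNaiveRep), and MotivatedTransfer (informal crux, rank 3) /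
AbelianHodgeDividend (informal support) stay untyped only until motivated classes have a
presentation on affine models (definition request AffineMotivatedPresentation, claimed 2026-08-16);
their signatures and glue are filed then (tenure). Rev 7–8 (route-repair 2026-08-16, badge + cone):
`closes` unchanged and re-certified; the partial-claim choice (a) of rev 2–3 stands — the complement
of the Γ-sector is the claimed crux CompleteModGammaSector, hypothesis h₂ of `closes`, so the route
decides the whole sub-problem statement; import KZProductIdeal dropped (every typed item elaborates
over Statement + PureNaivePeriodMap, rc 0); cone audit: no item takes KZ.PiCancellation,
KZ.PiLocalKernel or AffineAlgebraicDeRham as a hypothesis (needs-fact: none; they are co-located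
with the FormalRep product resp. AffineDeRham.PolyForm — fact-free module split requested,
defn-AffineDeRhamForms).

Rationale: WHY THIS LINE. The sibling correspondence routes (MultivaluedCoV) stop at ALGEBRAIC cycles and
concede that beyond divisors the action of Hodge classes on integrands leans on the Hodge
conjecture; but the rules calculus is a RING modulo its relations (KZProductIdeal, proved), and in a
ring the inverse of the hard-Lefschetz isomorphism is linear algebra: once cup-with-hyperplane and
Gysin/restriction are chains, Λ and the Lefschetz involution ⋆ are free, so the calculus is exactly
as strong as André's MOTIVATED cycles (Andre1996Motifs Déf. 1, Thm 0.3/0.4) — not merely algebraic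
ones. Imported area: the theory of motives (motivated cycles, Andre1996Motifs; absolute Hodge cycles
and the Γ-function, Deligne1982HodgeCycles §7, Gross1978; period torsors and Kontsevich's
presentation of formal periods, Andre2009GaloisMotives §3.5–4.4, HuberMullerStachPeriodsIII2015 §12,
Arapura2013) with the explicit dictionary motivated correspondence ↦ matrix identity A·P ≡ Q·B in
Mat(FormalRep² ⧸ relations₂), Λ ↦ A⁻¹, (2πi)^p ↦ 2^p·J^p(p!·[unit 2p-ball] × ·) on (Re, Im) pairs,
J(a,b) = (−b,a) (rev 5; the rev-0 token p!·[2p-ball] is worth π^p and survives only inside the REAL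
Γ-relations of GammaHodgeSector), smooth projective X ↦ its Jouanolou affine homotopy model X̃ =
V(I) (Jouanolou1973), on which the landed PureNaivePeriodMap presents every cohomological degree.
Payoff: André's THEOREM 0.6.2 makes every Hodge class on an abelian variety motivated, so the
abelian sector of Conjecture 1 (Hodge-type Γ-monomial relations incl. Das's non-standard ones,
Shimura CM relations, Weil-class determinants, K3 lattices via motivated Kuga–Satake) becomes an
UNCONDITIONAL target of the rules calculus; no prior route addresses it. Scope (rev 2): the route
decides the WHOLE of Conjecture 1 — the complement of the Γ-sector is the conjecture-grade crux
CompleteModGammaSector (one item shared with TerasomaMultiplication), so `closes (h₁ :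
GammaHodgeSector) (h₂ : CompleteModGammaSector) : KontsevichZagierPeriods`; the mechanism is aimed
at (i) = GammaHodgeSector, and (ii) is owned, ranked and exposed to refutation rather than
delegated.

RANKED CRUXES. #2 GammaHodgeSector (crux) — Γ-HODGE SECTOR (Deligne1982HodgeCycles Thm 7.18 in beta
form, as a ∀-statement of the RULES calculus): for positive non-integer rationals with the decidable
Hodge-type condition Σ_j(⟨ux_j⟩+⟨uy_j⟩−⟨u(x_j+y_j)⟩) − Σ_l(…) = k for every u ≥ 1 coprime to all
denominators, the cube rep [(0,1)^N, Π t_j^(x_j−1)(1−t_j)^(y_j−1)] and the rep [unit 2k-ball ×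
(0,1)^N', c·k!·Π(…)] (c real algebraic) are KZ-equivalent whenever their values agree. Predicted by
MotivatedTransfer + André 0.6.2 with NO algebraic cycle needed; decisive range N+N' ≥ 4 with
composite denominators, where the Deligne classes on F_d^(N+N') are not known algebraic
(Shioda1979HodgeFermat, Aoki1987) and the only other derivations square the identity first (Das2000;
AndersonBrownawellPapanikolas2004 §1.1.6) or detour through exponential periods (route
ExpConservative). Contains Neg's triplication pair (stmt-0311/0312) at N=2, N'=0, k=1 and (rev 5)
the calibration pair B(½,½) = π at N=1, N'=0, k=1 — the Im-part of the hyperplane period 2πi of ℙ¹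
on its Jouanolou model. [difficulty: XL] (why it might fail: The fixed calculus may be strictly
weaker than motives (route Neg: an additive invariant of FormalRep killing the four move sets but
separating one Hodge-type pair refutes it), or the motivated chain needs absolutely
divergent/regularised intermediates.) [Deligne1982HodgeCycles, Das2000,
AndersonBrownawellPapanikolas2004, Shioda1979HodgeFermat, Aoki1987, Andre1996Motifs,
KontsevichZagier2001]
#3 MotivatedTransfer (crux, informal; RESTATED rev 5 after refuter rattack-3891-0's
refuted-misstated verdict on stmt-3891 — frame + normalisation) — THE ENGINE, on AFFINE HOMOTOPY
MODELS: for the canonical pure naive period map (a PureNaivePeriodMap over a number field K ⊂ ℂ,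
pullback-normalised and with Stokes — crux #7), evaluated on Jouanolou torsors X̃ = V(I) → X of
smooth projective X, Y (closed polynomial forms present H^i_dR in EVERY degree, closed admissible
cubical cycles in X̃(ℂ) present H_i; the old frame 'affine open U ∋ γ' saw only Im(H_i(U(ℂ)) →
H_i(X(ℂ))) = 0 for i > dim X, AndreottiFrankel1959), every period identity induced by a motivated
correspondence ξ ∈ A_mot(X × Y) (André Déf. 1) holds in FormalRep² modulo relations₂, algebraic
scalars acting by cmul with constant representations and (2πi)^s by 2^s·J^s(s!·[B^{2s}] × ·); cycle
classes act by Gysin/restriction chains + sheet transfer, Künneth = KZProductIdeal, Λ = a matrix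
inverse modulo relations (LefschetzInversionFree + ConstantMatrixUnit). Sharpened (refuter):
cohomologically a theorem (André's category embeds in pure Nori motives, Arapura2013 §6; Nori's
formal period ideal is generated by linearity, morphisms of pairs, connecting morphisms,
HuberMullerStachPeriodsIII2015 Def. 12.1.1/Thm 12.1.3), so what is open is that the normalised Φ
turns those three relation types into KZ moves on the effective diagram of affine pairs.
[difficulty: XL] (why it might fail: Gysin by tubes needs full Stokes on non-closed admissible
chains with absolutely convergent semialgebraic intermediates; Nori routes motivated identities
through relative pairs, so a pure-only transfer may not close; Neg's invariant hunt on
B(1/9,4/9)B(5/9,7/9) is the first test.) [Andre1996Motifs, Jouanolou1973, AndreottiFrankel1959,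
Arapura2013, HuberMullerStachPeriodsIII2015, DelfsKnebusch1982, KontsevichZagier2001]
#4 GammaHodgePairs (crux) — DIVISOR RANGE N+N' = 2 of GammaHodgeSector (shapes B·B = c·π and B =
c·B'): the Deligne class lives in H² of F_d × F_d and is a divisor class, i.e. an honest algebraic
correspondence between CM factors of J(F_d) (HuberWustholz2022: ℚ̄-linear relations of 1-periods are
isogeny-induced) — the first test of the ENGINE without André and without Λ, needing only the
cohomology CLASS although the isogeny is inexplicit (Das2000). Instances: stmt-0312
TriplicationAccessible (shared by Neg/ExpConservative/MultivaluedCoV), LowDimension's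
LowdimDuplicationOneThird, Das's B(4/15,1/5) ∝ B(1/3,2/15). [difficulty: L] (why it might fail: Even
for divisor classes the Gysin/tube chain on F_d×F_d ⊂ ℝ^8 must stay absolutely convergent at the
points at infinity; if explicit isogenies are needed instead, Das's pairs have none in print.)
[Das2000, HuberWustholz2022, Deligne1982HodgeCycles, Aoki1987, KontsevichZagier2001]
#9 AbelianHodgeDividend (support, informal; crux rank 5 until rev 8) — ANDRÉ DIVIDEND:
MotivatedTransfer (rev-5 frame) ∧ André 1996 Thm 0.6.2 (Hodge classes on abelian varieties are
motivated; hypothesis h062 at the classical datum only) ⇒ every Hodge-class period relation of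
abelian type (abelian varieties over ℚ̄, products of curves, Fermat hypersurfaces, powers and
products of K3 surfaces via motivated Kuga–Satake) is a KZ relation, in (Re, Im) pairs with (2πi)^p
↦ 2^p·J^p(p!·[B^{2p}] × ·); GammaHodgeSector is its sharpest typed instance. Re-badged SUPPORT at
rev 8 on the refuter's crux-attack (rattack-3892-0, ATTACK.md on stmt-3892): F1 the auto-crux
promotion was a false positive (namespace token only); F2 it is near-glue — MotivatedTransfer at X =
pt composed with André 1996 Thm 0.6.2, Scolie 2.5 (A_mot(V_ℂ) = A_mot(V_ℚ̄)) and Thm 0.6.3/7.1, all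
in print, the independent content being (2πi)^p/Re–Im/basis bookkeeping (difficulty L); F3 the
single-K3 clause was degenerate (Lefschetz (1,1)) and now reads 'powers and products'; F4 datum
hygiene for the future signature (h062 never at a free B; Hodge classes decoration-free or ξ ∈
A_mot). Re-filed as a fresh informal support item with this text (stmt-3892 dropped; its
notes/evidence are the record); re-badge crux on typing only if the bookkeeping proves non-routine.
[Andre1996Motifs, Deligne1982HodgeCycles, KontsevichZagier2001]
#6 CompleteModGammaSector (crux, conjecture-grade; ONE item stmt-KontsevichZagierPeriods-14233
shared with TerasomaMultiplication) — CONJECTURE 1 FOR THE Γ-ENLARGED CALCULUS, subgroup form: every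
additive subgroup H ≥ KZ.relations containing [ρ] − [ρ′] for every Γ-Hodge pair (ρ, ρ′) exactly as
in GammaHodgeSector (ρ.value = ρ′.value) contains [r] − [r′] for all rational r, r′ of equal value;
equivalently `ker KZ.eval ≤ KZ.relations ⊔ closure{Γ-pair differences}` (Sketch2.lean rc 0);
summit-implied, and with GammaHodgeSector the deciding theorem. It is the complement of the abelian
sector inside Conjecture 1 — mixed Tate/MZV, non-CM elliptic, exponential detours — i.e.
Grothendieck-period-conjecture strength (HuberMullerStachPeriods2017 Prop. 13.2.6, Ayoub2014 Cor.
32); true sub-sectors: 1-periods (HuberWustholz2022 Thm 13.3), the relative version (Ayoub2015 Thm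
4.25); every kernel-form route of the summit implies it and its standing disprover attacks it.
[difficulty: open-problem] (why it might fail: Summit-strength off the Γ-sector (forces algebraic
independence of odd zetas: barrier kzConjecture_implies_oddZetaAlgIndep); false if an additive
invariant of FormalRep kills the 4 move sets and all Γ-pairs yet separates two equal-valued reps, or
if period equality is undecidable.) [KontsevichZagier2001, HuberMullerStachPeriods2017, Ayoub2014,
Ayoub2015, HuberWustholz2022, Fresan2024]
#7 NaivePeriodMapExists (crux, TYPED; rev 5) — CONSTRUCTION OF THE TRANSFER DATUM, kept separate
from the interface at open and typable since defn-PureNaivePeriodMap landed: for every number field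
K with σ : K →+* ℂ there is a PureNaivePeriodMap K σ that is (i) PULLBACK-NORMALISED — Φ(ω, φ) ≡
([(0,1)^i, Re (φ*ω^σ)(∂₁φ,…,∂ᵢφ)], [(0,1)^i, Im …]) mod relations₂ whenever these canonical
representations exist (always: support CanonicalNaiveRep) — and (ii) satisfies STOKES Φ(dα, c) ≡
Φ(α, ∂c) for every admissible cubical chain (implies `exact`, `boundary`; the engine needs it on
non-closed chains). With (i) the other axioms are single moves; the content is (ii): Stokes along
stratified-smooth semialgebraic cubes is a ℤ-combination of band Newton–Leibniz moves with fibrewise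
primitives continuous on closed fibres off a null base set. HMS's 'naive ⊆ KZ periods'
(HuberMullerStachPeriodsIII2015 Thm 11.2.4) made move-exact; all normalised P agree mod relations₂
(Sketch.lean `normalised_unique`, rc 0), de-vacuifying #3 and #5 (refuter: 'pair with
Nonempty(PureNaivePeriodMap)'). Rank 7 = most tractable, not least informative. [difficulty: XL]
(why it might fail: refuter rattack-14697-0 (SURVIVES, 2026-08-16): for C⁰-boundary admissible cubes
the coordinate split of Stokes has non-L¹ terms — rational 2-cube Y = t⁵/(t⁴+(s−½−t)²) with ∫∫|Y_st|
= ∞ — so band Newton–Leibniz needs a preparation/rectilinearisation theorem first; one bad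
admissible chain kills the typed ∃, while C¹-up-to-the-boundary cubes (OhmotoShiota2017; repaired
admissibility C′ noted by the refuter) survive.) [HuberMullerStachPeriodsIII2015,
HuberMullerStachPeriodsI2015, KontsevichZagier2001, OhmotoShiota2017, BochnakCosteRoy1998,
Spivak1965]
#9 LefschetzInversionFree (support) — LEFSCHETZ INVERSION IS FREE (card item (c); two candidate
proofs attached to stmt-3744, grounder g13-5 and a route-review refuter, rc 0 — land verbatim): in
the non-unital ring FormalRep with two-sided ideal `relations` (KZProductIdeal, a prover-side import
since rev 8), if Ainv is a left inverse of A modulo relations and the entrywise Lefschetz identities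
A·P ≡ Q·B hold modulo relations, then P ≡ Ainv·Q·B entrywise — no inverse of the Betti matrix, no
algebraicity of Λ; ~20 lines, proved in a grounder's scratch. [difficulty: provable-now]
[Andre1996Motifs, Kleiman1968, KontsevichZagier2001]
#9 ConstantMatrixUnit (support) — discharges LefschetzInversionFree's unit hypothesis for matrices
of ALGEBRAIC CONSTANTS: if ainv·a = 1 in Mat_d(ℝ) and R, Rinv are the matrices of constant
representations [pt, a_lj], [pt, ainv_il], then Σ_l [Rinv_il]·([R_lj]·x) ≡ δ_ij·x modulo relations
for every x ∈ FormalRep (integrand additivity, zero integrand, reindexing). [difficulty: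
provable-now] [KontsevichZagier2001, HuberMullerStachPeriods2017]
#9 CanonicalNaiveRep (support, TYPED; rev 5) — the Re/Im parts of the pulled-back top coefficient t
↦ ω^σ(φ t)(∂₁φ,…,∂ᵢφ) of a polynomial form along an admissible cube are ℚ-semialgebraic and
absolutely integrable on (0,1)^i (minors ≤ i-Jacobian; area formula with a.e.-bounded multiplicity
of bounded semialgebraic images), i.e. the canonical KZ.IntegralRep's exist — the
absolute-convergence half of HMS Thm 11.2.4 for cubes; de-vacuifies the normalisation clause of
#7/#3. [difficulty: L] [HuberMullerStachPeriodsI2015, BochnakCosteRoy1998, Federer1969,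
KontsevichZagier2001]

TWO-LAYER PLAN. Foreseen glued splits (none filed now): MotivatedTransfer ⇐ CyclesAct (cup with an
algebraic cycle class = Gysin/restriction chain via a semialgebraic tube and fibrewise residues on
the affine model; sheet transfer for finite pieces; uses Stokes of #7 on non-closed chains) →
PoincareKunneth (bilinear relations from `mul` + `boundary` on X̃ × X̃: the diagonal is homologous
to Σ I⁻¹_ab γ_a × γ_b by a semialgebraic boundary) → MotivatedTransfer (glue =
LefschetzInversionFree + ConstantMatrixUnit + KZProductIdeal); NaivePeriodMapExists ⇐ StokesInMoves
(conjunct (ii) for one admissible cube) → CanonicalNaiveRep → NaivePeriodMapExists (glue: Φ :=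
canonical representations; the other axioms are one move each); GammaHodgeSector ⇐
FermatStandardReps (canonical reps of Fermat-curve eigenperiods on the Jouanolou model ≡ beta cube
reps by change of variables; (2πi)^k ≡ 2^k·J^k(k!·[B^{2k}] × ·)) → AbelianHodgeDividend restricted
to products of Fermat curves → GammaHodgeSector; GammaHodgePairs ⇐ shape B·B = cπ → shape B = cB'.

KILL CRITERIA. An additive invariant ι : FormalRep →+ A vanishing on the four move sets and
separating ONE Hodge-type beta pair (Neg's obstruction shape stmt-0313) refutes
GammaHodgePairs/GammaHodgeSector and with them the summit — close `refuted:GammaHodgeSector`, hand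
the witness to Neg. A proof that Stokes along some admissible cubical chain, or Gysin/restriction
for some smooth pair Z̃ ⊂ X̃, cannot be realised with absolutely convergent semialgebraic
intermediates refutes NaivePeriodMapExists resp. MotivatedTransfer as stated — if the witness cube
is merely not C¹ up to the boundary, amend the admissibility predicate (OhmotoShiota2017) and
restate; otherwise pivot to a cohomology-level (regularised) calculus or close. If MultivaluedCoV +
ExpConservative derive the whole Γ-sector first, this route is superseded on its typed deliverable
but keeps the Weil/K3 harvest. An additive invariant ι : FormalRep →+ A vanishing on the four move
sets AND on every Γ-Hodge pair difference but not on ker eval — e.g. one separating the two sides of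
a single MZV or elliptic identity between rational representations — refutes CompleteModGammaSector
and the summit with it (close `refuted:CompleteModGammaSector`, hand the witness to Neg and to the
kernel routes); an undecidability theorem for equality of periods on an effective SYNTACTIC coding
(barrier not_complete_of_undecidable, premise open) does the same.

NOT DECOMPOSED YET. CyclesAct / PoincareKunneth / StokesInMoves as separate items (layer-2 children
of MotivatedTransfer and NaivePeriodMapExists, filed when a prover proposes the split or #7 moves);
the typing of MotivatedTransfer and AbelianHodgeDividend themselves, which needs a presentation of
motivated classes (tree `WeilCohomology.IsMotivatedClass`, abstract Weil cohomology) by closed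
polynomial forms / admissible cycles on Jouanolou models with their comparison — definition request
AffineMotivatedPresentation (rev 5); functoriality of the normalised Φ along polynomial maps (free
once PolyForm pull-back exists — part of that request); the Shimura-CM, Weil-class and
K3/Kuga–Satake (powers/products) instances of AbelianHodgeDividend as typed statements, and
AbelianHodgeDividend's own signature + crux/support badge once AffineMotivatedPresentation lands;
the smallest N+N' = 4 composite-denominator test pair (Shioda's open list / Das's tables);
CompleteModGammaSector (crux #6) is deliberately left WHOLE (its decomposition by motive type is the
business of the kernel-form routes; a tenure split only after a sector kernel theorem `ker eval ⊓
⟨sector⟩ ≤ relations` lands or the disprover isolates where an invariant bites).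

CHEAPEST FALSIFIER. (1) Enumerate Hodge-type beta relations with denominators d ≤ 30 and N+N' ≤ 4
(finite, Kubert/Das lattices) and check to 50 digits that each predicted c = value·π^(−k)/M' is
algebraic of small height (PSLQ) — a failure means the typed hypothesis is mis-transcribed and the
crux must be restated before staffing. (2) The real cheapest kill of the sector is Neg's invariant
hunt on the triplication pair (stmt-0311), already staffed. (3) For crux (ii): run the disprover's
FormalRep invariants (Disproof.lean of stmt-10378: weight/evaluation-type invariants are neutral
modulo the Γ-sector so far) against ONE genuine non-Γ pair of rational representations — two simplex
representations related by a regularised double-shuffle identity beyond the duality/shuffle/stuffle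
moves in the tree (e.g. Hoffman's relation, the OPEN item HoffmanRelationInKZ of route
FurushoPentagon) — an invariant separating them kills (ii) and the summit; cost: one Lean file over
KZCalculus. (4) For crux #7 (rev 5): ONE explicit admissible 2-cube with a boundary layer, e.g.
c(t,s) = (t, t(s−½)/√(t²+(s−½)²)) with α = x dy: write both sides of Stokes as canonical
representations and connect them by moves, or prove no finite chain of rules 1–3 with semialgebraic
data does — the latter kills NaivePeriodMapExists as typed (and triggers the C¹-admissibility
amendment, not the death of the line).

NUMBERS. Deligne1982HodgeCycles Thm 7.15 (held book pp. 73–75): ⟨ua⟩ = ⟨a⟩ ∀ u ∈ (ℤ/d)^× ⇒ Γ̃(a) =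
(2πi)^(−⟨a⟩)ΠΓ(a_i/d) ∈ ℚ̄; Thm 7.18 (p. 77): Σ n(b)⟨ub⟩ = c constant ⇒ (2πi)^(−c)ΠΓ(⟨b⟩)^n(b) ∈
k^ab. Calibration values: B(1/9,4/9)·B(5/9,7/9) = 2·3^(7/6)·π = 22.63712829… (Neg 0311); Das/ABP:
Γ(4/15)Γ(1/5)/(Γ(1/3)Γ(2/15)) ∈ ℚ̄ (k = 0, N = N' = 1 in beta form). vol(unit 2k-ball) = π^k/k!, so
(2πi)^k = 2^k·k!·vol(B^{2k})·i^k and i ↦ J on (Re, Im) pairs (rev 5 token). Hyperplane calibration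
(rev 5): on the Jouanolou model {p ∈ M₂ : p² = p, tr p = 1} of ℙ¹, tr(p dp dp) on the 2-sphere of
hermitian projectors p = (1 + x·σ)/2 is (i/2)·(area form), total 2πi; along the hemisphere cube
(u,v) ↦ (X, Y, √(1−X²−Y²)), X = 2u−1, Y = (2v−1)√(1−X²), the Im-integrand is 1/√(v(1−v)), i.e.
B(½,½) = π = [B², 1] per hemisphere. Items at open: 7 + 2 informal cruxes + 1 definition request.
Rev 1 (2026-08-15, glue): + GammaSectorComplete, − SummitOffGammaSector, `closes` filed. Rev 2–3
(route-choice 2026-08-16 (a)): the complement crux converged on the ONE shared item stmt-14233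
CompleteModGammaSector (stmt-10378, stmt-14267 moot), `closes` = three-line λ-term re-certified;
MotivatedTransfer crux #3, AbelianHodgeDividend crux #5 (retriage). Rev 5 (route-repair 2026-08-16,
refuted-misstated informal crux stmt-3891): MotivatedTransfer RESTATED on affine homotopy models
with the corrected (2πi)^s token (new informal item, rank 3; stmt-3891 dropped → moot, its refuter
notes are the record), + typed crux #7, + typed support CanonicalNaiveRep, #5 why-line retriaged,
definition request AffineMotivatedPresentation; `closes` untouched. Items after rev 5: 6 cruxes (4
typed-or-shared: GammaHodgeSector, GammaHodgePairs, CompleteModGammaSector, NaivePeriodMapExists; 2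
informal), 3 supports, 1 assembly = 10. Rev 7–8 (route-repair 2026-08-16T07Z, badge + cone, planner
rbadge-g3; rev 7 = retriage pass, rev 8 = this edit): (1) partial-claim: choice (a) of rev 2–3
confirmed — the complement crux CompleteModGammaSector is hypothesis h₂ of `closes`, nothing is left
outside the claim (the 02:41Z hold predates rev 2 and is stale); (2) AbelianHodgeDividend crux →
informal support on refuter rattack-3892-0 F1/F2, text re-filed with F3/F4; NaivePeriodMapExists
why-line sharpened with rattack-14697-0's obstacle (vetted 06:27Z, survives); (3) import
KZProductIdeal dropped — every typed item elaborates over Statement + PureNaivePeriodMap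
(Sketch.lean rc 0, closes axioms propext/Classical.choice/Quot.sound); (4) cone audit of the five
unproved facts in the module cone — KZ.PiCancellation, KZ.PiLocalKernel (AyoubSpecialisation's
@[conjecture] theses, co-located with the FormalRep product in KZProduct.lean, imported by 16 other
KZ routes), KZ.ProdFunSemialgebraic (discharged: KZProductIdeal `prodFunSemialgebraic_holds`),
AffineAlgebraicDeRham (Grothendieck's comparison, XL, co-located with
AffineDeRham.PolyForm/extDeriv): needs-fact NONE — no item, no glue and no foreseen child takes any
of them as a hypothesis (the engine integrates polynomial forms over cubical cycles and compares
VALUES by eval; the de Rham comparison enters only the future presentation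
AffineMotivatedPresentation, as data); structural fix requested: defn-AffineDeRhamForms (fact-free
module for PolyForm/extDeriv/vanishingForms/RegularForm, re-imported by AffineAlgebraicDeRham.lean
and PureNaivePeriodMap.lean), and — for AyoubSpecialisation's planner or the operator — moving the
two @[conjecture] defs out of KZProduct.lean. Items after rev 8: 5 cruxes (GammaHodgeSector,
MotivatedTransfer [informal], GammaHodgePairs, CompleteModGammaSector, NaivePeriodMapExists), 4
supports (LefschetzInversionFree, ConstantMatrixUnit, CanonicalNaiveRep, AbelianHodgeDividend
[informal]), 1 assembly = 10.

DEFINITION REQUESTS. PureNaivePeriodMap — LANDED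
(Literature/NumberTheory/Transcendental/PureNaivePeriodMap.lean: Φ on polynomial forms × singular
cubes → FormalRep², axioms modulo relations₂, onChain, ∂∂ = 0 proved); its frame (any V(I) ⊆ 𝔸ᴺ)
fits the Jouanolou models of rev 5 verbatim, and the construction statement promised at open is now
the typed crux #7 (with the two strengthenings the engine needs and the interface lacks:
pullback-normalisation and full Stokes). NEW (rev 5) AffineMotivatedPresentation: the bridge needed
to TYPE #3/#5 — for smooth projective X, Y over a number field with Jouanolou models V(I), V(I′):
(a) pull-back of AffineDeRham.PolyForm along polynomial maps and the de Rham cycle class of an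
algebraic cycle on V(I) × V(I′) as a closed polynomial form; (b) 'these closed polynomial forms /
closed admissible cubical cycles represent bases of H_dR / H_B of X under the classical comparison
(periods = NaivePeriods.CubicalChain.integral)'; (c) the predicate 'ξ = pr_*(α ∪ ⋆β) is motivated
with matrices (M, B, s) in these bases' (André Déf. 1; the tree's WeilCohomology.IsMotivatedClass
lives on an abstract Weil cohomology and does not yet meet (a)–(b)). NEW (rev 8) AffineDeRhamForms —
not a new notion but a FACT-FREE MODULE: move the sorry-free definitions AffineDeRham.PolyForm,
PolyForm.map, extDeriv (+ extDeriv_extDeriv, extDeriv_smul, dWedge), vanishingForms, RegularForm,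
DeRhamCohomology, IsClosedOn/IsExactOn out of
Literature/AlgebraicGeometry/Motives/AffineAlgebraicDeRham.lean into
Literature/AlgebraicGeometry/Motives/AffineDeRhamForms.lean (verbatim, names unchanged), leaving in
AffineAlgebraicDeRham.lean only the named fact `AffineAlgebraicDeRham` and its corollary over an
`import …AffineDeRhamForms`; PureNaivePeriodMap.lean and the coming AffineMotivatedPresentation
import the forms module. Effect: the typed engine items (NaivePeriodMapExists, CanonicalNaiveRep,
later MotivatedTransfer) stop carrying Grothendieck's XL comparison fact in their module cone. Cite
fact wanted: none new (André 0.6.2 stays the B-parametrised predicate of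
Literature/Barriers/HodgeConjecture/MotivatedClassesAbelianVarieties.lean, used as hypothesis h062);
needs-fact: none.

Novelty: Searches (2026-08-15): `lit search --hybrid "motivated cycles period relations Kontsevich Zagier
conjecture abelian varieties"` (12 book
hits: Deligne LNM 900, Huber–Wüstholz, Kerr–Pearlstein… — none on the rules form); `lit search
--hybrid "Gamma function algebraic values
Hodge type beta integrals Kontsevich Zagier rules"` (10: LNM 900, arXiv:1407.2388 'What is a
period?', …); `lit search --hybrid "Lefschetz
involution motivated cycles standard conjecture B period relations"` (10 Hodge-theory textbooks, no
period-calculus hit); `lit search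
--source zbmath "algebraic gamma monomials"` (Das2000, AndersonBrownawellPapanikolas2004, Anderson
2002 Kronecker–Weber+ε) and `"motivated
cycles period conjecture abelian varieties"` (1: Bost 2013); `lit frontier KontsevichZagierPeriods
--since 2020` (30 rows; nearest: Kawabe2026
= arXiv:2303.05030, GPC for CM Kummer surfaces — transcendence side, K3 sector); `lit bridges
--cross any`; `lit galaxy search "motivated
cycles" --star all/pdf` (0 / noise); reads: Deligne1982HodgeCycles pp. 66–78 (Thm 7.15, 7.18, Rem
7.16 Koblitz–Ogus), Andre2009GaloisMotives
§§3.4–4.4 (period torsor; 'Kontsevich's conjecture is equivalent to Grothendieck's via Nori'); tree: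
MotivatedCycles.lean,
Barriers/HodgeConjecture/MotivatedClassesAbelianVarieties.lean, KZProductIdeal.lean, all 10 KZ
Theses, cards correspondences-as-multivalued-cov,
riemann-bilinear-unnesting-triplication-isogeny, cycle-shadow-of-moves,
integral-domain-roots-of-identities; negatives index  [refs: 1407.2388, 2303.05030, Das2000, AndersonBrownawellPapanikolas2004, Kawabe2026]

Barriers (technique_class: motivated-cycles, lefschetz-inversion, cycle-class-transfer): - technique_class: motivated-cycles, lefschetz-inversion, cycle-class-transfer
- Literature.Barriers.KontsevichZagierPeriods.kzConjecture_implies_oddZetaAlgIndep: it APPLIES and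
is not evaded — since rev 2 the route decides the whole summit, and by construction the barrier's
bite is concentrated in crux #6 CompleteModGammaSector (summit-strength off the Γ-sector: on MZV
simplex representations it forces algebraic independence of ζ(3), ζ(5), …); the bet of THIS line is
placed only on the Γ/abelian sector (cruxes #2–#5), whose identities are already theorems
numerically (Deligne's absolute-Hodge relations), so no transcendence or independence statement is
asserted there; crux #6 is ranked last, left whole, and exposed to the standing disprover (the same
holds for the companions kzConjecture_implies_twoPiI_log_algIndep and
kzConjecture_implies_ellipticPeriods_algIndep, whose bite also lands in #6).
- Literature.Barriers.KontsevichZagierPeriods.noSemialgebraicPrimitive_inv_sub_two: evaded —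
Newton–Leibniz is used only for EXACT ALGEBRAIC forms (algebraic primitives) and for fibrewise
residues of algebraic forms on semialgebraic tubes; no primitive of a general algebraic integrand is
ever taken, and variables are added freely (tubes, products), never eliminated.
- Literature.Barriers.KontsevichZagierPeriods.cressonViuSos_prop_3_2: not engaged — every chain uses
dissection (domain additivity) and many maps; no single global change of variables between the two
representations is pro

History (route lifecycle, newest last):
- 2026-08-16T03:13:12Z · rev 2: dropped GammaSectorComplete — route-choice (partial-claim hold 2026-08-16T02:41Z), option (a) ADD THE COMPLEMENT AS A CRUX: + crux #6 CompleteModuloGammaSector = completeness of the calculus (planner-rchoice-KontsevichZagierPeriods-Motiva-20ecf6a7-0)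
- 2026-08-16T03:24:44Z · rev 3: restated Assembly (stmt-KontsevichZagierPeriods-14266) — route-choice (a), convergence pass: TerasomaMultiplication's parallel route-choice filed the complement crux first (stmt-14233 CompleteModGammaSector, subgroup (planner-rchoice-KontsevichZagierPeriods-Motiva-20ecf6a7-0)
- 2026-08-16T03:24:44Z · rev 3: dropped CompleteModuloGammaSector — route-choice (a), convergence pass: TerasomaMultiplication's parallel route-choice filed the complement crux first (stmt-14233 CompleteModGammaSector, subgroup (planner-rchoice-KontsevichZagierPeriods-Motiva-20ecf6a7-0)
- 2026-08-16T06:08:15Z · rev 5: dropped MotivatedTransfer — rev 5 route-repair (refuted-misstated INFORMAL crux stmt-3891 MotivatedTransfer, refuter rattack-3891-0 2026-08-16T04:26Z, evidence EVIDENCE.md/Scratch.lean): F (planner-rrefute-KontsevichZagierPeriods-Motiva-30df5874-0)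
- 2026-08-16T06:45:25Z · rev 8: dropped stmt-KontsevichZagierPeriods-3892 — route-repair rbadge-g3 (rev 8; rev 7 = retriage pass): partial-claim STALE — choice (a) stands since rev 2–3 (complement crux CompleteModGammaSector = h₂ of clo (planner-rbadge-KontsevichZagierPeriods-Motivat-845f87ee-g3-0)
- 2026-08-23T19:47:16Z · DORMANT — reconciler: no traction for 6.2 d (last activity item-evidence-added at 2026-08-17T14:26:07Z); parked, not closed — `ledger route dormant route-KontsevichZagier (operator:999:2946562)
- 2026-08-30T06:27:30Z · REACTIVATED — reconciler: reactivated — activity item-evidence-added at 2026-08-30T05:32:51Z after parking at 2026-08-23T19:47:16Z (operator:999:2876256)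
- 2026-09-04T09:11:00Z · DORMANT — reconciler: no traction for 5 d (last activity item-evidence-added at 2026-08-30T08:26:47Z); parked, not closed — `ledger route dormant route-KontsevichZagierPe (operator:999:1302168)

sub-problem: KontsevichZagierPeriods · status: dormant · opened planner-plancard-KontsevichZagierPeriods-Kont-e35d140d-0 2026-08-15T11:23:32Z · rev 9 · ledger route-KontsevichZagierPeriods-MotivatedMoves
GENERATED by the gate from the ledger (D-0016/17). Provers cite these decls: `theorem foo : Summit.KontsevichZagierPeriods.KontsevichZagierPeriods.Theses.MotivatedMoves.<Decl> := …` in Summits/KontsevichZagierPeriods/KontsevichZagierPeriods/Theorems/<Name>.lean.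
-/

namespace Summit.KontsevichZagierPeriods.KontsevichZagierPeriods.Theses.MotivatedMoves

open scoped BigOperators Topology Manifold Classical MeasureTheory ProbabilityTheory Matrix InnerProductSpace ComplexConjugate ContinuousMap
open Filter Set Function TopologicalSpace MeasureTheory

attribute [summit_statement] _root_.KontsevichZagierPeriods

open Literature Periods

/-- item stmt-KontsevichZagierPeriods-3742 · crux · rank 2 · open · by planner
why it might fail: The fixed calculus may be strictly weaker than motives (route Neg: an additive invariant of FormalRep killing the four move sets but separating one Hodge-type pair refutes it), or the motivated chain needs absolutely divergent/regularised intermediates.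
sources: Deligne1982HodgeCycles, Das2000, AndersonBrownawellPapanikolas2004, Shioda1979HodgeFermat, Aoki1987, Andre1996Motifs
[crux] Γ-HODGE SECTOR (Deligne1982HodgeCycles Thm 7.18 in beta form, as a ∀-statement of the RULES
calculus). For positive non-integer rationals (x_j,y_j)_(j<N), (x'_l,y'_l)_(l<N') with the
Hodge-type condition Σ_j(⟨ux_j⟩+⟨uy_j⟩−⟨u(x_j+y_j)⟩) − Σ_l(…) = k for every u ≥ 1 coprime to all
denominators (decidable; Deligne: then ΠB(x_j,y_j) = c·π^k·ΠB(x'_l,y'_l) with c real algebraic), the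
cube rep [(0,1)^N, Π t_j^(x_j−1)(1−t_j)^(y_j−1)] and the rep [unit 2k-ball × (0,1)^N', c·k!·Π(…)]
are KZ-equivalent whenever their values agree (value equality and algebraicity of c are hypotheses:
no transcendence in the Lean proof). Predicted by MotivatedTransfer + André 0.6.2 (Fermat motives
lie in the tensor category of abelian varieties) with NO algebraic cycle needed; decisive range N+N'
≥ 4 with composite denominators, where the Deligne classes on F_d^(N+N') are not known algebraic
(Shioda1979HodgeFermat, Aoki1987) and the only other derivations square the identity first (Das2000;
AndersonBrownawellPapanikolas2004 §1.1.6) or detour through Γ = exponential periods (route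
ExpConservative). Contains Neg's triplication pair (stmt-0311/0312) at N=2, N'=0, k=1. [difficulty:
XL] -/
@[route_item "route-KontsevichZagierPeriods-MotivatedMoves"]
def GammaHodgeSector : Prop :=
  ∀ (N N' k : ℕ) (x y : Fin N → ℚ) (x' y' : Fin N' → ℚ) (c : ℝ), (∀ j, 0 < x j ∧ 0 < y j ∧ Int.fract (x j) ≠ 0 ∧ Int.fract (y j) ≠ 0) → (∀ l, 0 < x' l ∧ 0 < y' l ∧ Int.fract (x' l) ≠ 0 ∧ Int.fract (y' l) ≠ 0) → (∀ u : ℕ, 0 < u → (∀ j, Nat.Coprime u (x j).den ∧ Nat.Coprime u (y j).den) → (∀ l, Nat.Coprime u (x' l).den ∧ Nat.Coprime u (y' l).den) → ((∑ j, (Int.fract ((u : ℚ) * x j) + Int.fract ((u : ℚ) * y j) - Int.fract ((u : ℚ) * (x j + y j)))) - ∑ l, (Int.fract ((u : ℚ) * x' l) + Int.fract ((u : ℚ) * y' l) - Int.fract ((u : ℚ) * (x' l + y' l)))) = (k : ℚ)) → IsAlgebraic ℚ c → ∀ (r : Literature.NumberTheory.Transcendental.KZ.IntegralRep N) (r' :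 Literature.NumberTheory.Transcendental.KZ.IntegralRep (2 * k + N')), r.domain = {t | ∀ j, t j ∈ Set.Ioo (0:ℝ) 1} → Set.EqOn r.integrand (fun t => ∏ j, (t j) ^ ((x j : ℝ) - 1) * (1 - t j) ^ ((y j : ℝ) - 1)) r.domain → r'.domain = {z | (∑ i : Fin (2 * k), (z (Fin.castAdd N' i)) ^ 2) < 1 ∧ ∀ l : Fin N', z (Fin.natAdd (2 * k) l) ∈ Set.Ioo (0:ℝ) 1} → Set.EqOn r'.integrand (fun z => c * (k.factorial : ℝ) * ∏ l, (z (Fin.natAdd (2 * k) l)) ^ ((x' l : ℝ) - 1) * (1 - z (Fin.natAdd (2 * k) l)) ^ ((y' l : ℝ) - 1)) r'.domain → r.value = r'.value → Literature.NumberTheory.Transcendental.KZ.Equivalent r r'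

-- item stmt-KontsevichZagierPeriods-14711 · crux · rank 3 · open · by planner — informal only, no Lean statement yet:
--   [crux] MOTIVATED TRANSFER, restated 2026-08-16 (supersedes the informal
--   stmt-KontsevichZagierPeriods-3891, refuted-misstated by refuter rattack-3891-0: FRAME +
--   NORMALISATION). FRAME = affine homotopy models (the landed interface applies verbatim): K ⊂ ℂ a
--   number field (σ : K →+* ℂ; every finite motivated datum over ℚ̄ descends to one), P :
--   PureNaivePeriodMap K σ PULLBACK-NORMALISED and satisfying STOKES (the two conjuncts of
--   NaivePeriodMapExists; all such P agree mod KZ.relations₂ on admissible cubes, i.e. Φ is THE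
--   canonical naive map Φ(ω, φ) ≡ ([(0,1)^i, Re φ*ω^σ(∂₁φ,…,∂ᵢφ)], [(0,1)^i, Im …])

/-- item stmt-KontsevichZagierPeriods-14233 · crux · rank 6 · open · by planner
why it might fail: Summit-strength off the Γ-sector (forces algebraic independence of odd zetas: barrier kzConjecture_implies_oddZetaAlgIndep); false if an additive invariant of FormalRep kills the 4 move sets and all Γ-pairs yet separates two equal-valued reps, or if period equality is undecidable.
sources: KontsevichZagier2001, HuberMullerStachPeriods2017, Ayoub2014, Ayoub2015, HuberWustholz2022, Fresan2024
[crux] CONJECTURE 1 FOR THE Γ-ENLARGED CALCULUS — the complement of GammaHodgeSector, CLAIMED by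
this route as its last-ranked crux (rev 7, route-choice (a): it replaces here the shared sup/closure
item stmt-KontsevichZagierPeriods-10378, kept by MotivatedMoves, by the SUBGROUP form). For every
additive subgroup H of FormalRep with KZ.relations ≤ H that contains the difference [ρ] − [ρ'] of
every Deligne–Koblitz–Ogus Γ-Hodge pair — ρ the cube representation [(0,1)^N, Π
t_j^(x_j−1)(1−t_j)^(y_j−1)], ρ' the representation [unit 2k-ball × (0,1)^N', c·k!·Π(…)], under
exactly the hypotheses of GammaHodgeSector (positive non-integer rational exponents, the decidable
Hodge-type condition via Int.fract, c real algebraic, equal values) — and for all RATIONAL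
representations r, r' (KZ.IntegralRep.IsRational, KZ §1.1 shape) of equal value: [r] − [r'] ∈ H.
Equivalently [r] − [r'] ∈ relations ⊔ closure(Γ-Hodge pair differences) (take H = that subgroup;
conversely sup_le): the planner's Sketch.lean kernel-checks CompleteModGammaSector ↔
GammaSectorComplete and KontsevichZagierPeriods → CompleteModGammaSector (rc 0), so the crux is
summit-implied (never stronger than the summit) and with GammaHodg -/
@[route_item "route-KontsevichZagierPeriods-MotivatedMoves"]
def CompleteModGammaSector : Prop :=
  ∀ H : AddSubgroup Literature.NumberTheory.Transcendental.KZ.FormalRep, Literature.NumberTheory.Transcendental.KZ.relations ≤ H → (∀ (N N' k : ℕ) (x y : Fin N → ℚ) (x' y' : Fin N' → ℚ) (c : ℝ), (∀ j, 0 < x j ∧ 0 < y j ∧ Int.fract (x j) ≠ 0 ∧ Int.fract (y j) ≠ 0) → (∀ l, 0 < x' l ∧ 0 < y' l ∧ Int.fract (x' l) ≠ 0 ∧ Int.fract (y' l) ≠ 0) → (∀ u : ℕ, 0 < u → (∀ j, Nat.Coprime u (x j).den ∧ Nat.Coprime u (y j).den) → (∀ l, Nat.Coprime u (x' l).den ∧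 Nat.Coprime u (y' l).den) → ((∑ j, (Int.fract ((u : ℚ) * x j) + Int.fract ((u : ℚ) * y j) - Int.fract ((u : ℚ) * (x j + y j)))) - ∑ l, (Int.fract ((u : ℚ) * x' l) + Int.fract ((u : ℚ) * y' l) - Int.fract ((u : ℚ) * (x' l + y' l)))) = (k : ℚ)) → IsAlgebraic ℚ c → ∀ (ρ : Literature.NumberTheory.Transcendental.KZ.IntegralRep N) (ρ' : Literature.NumberTheory.Transcendental.KZ.IntegralRep (2 * k + N')), ρ.domain = {t | ∀ j, t j ∈ Set.Ioo (0:ℝ) 1} → Set.EqOn ρ.integrand (fun t => ∏ j, (t j) ^ ((x j : ℝ) - 1) * (1 - t j) ^ ((y j : ℝ) - 1)) ρ.domain → ρ'.domain = {z | (∑ i : Fin (2 * k), (z (Fin.castAdd N' i)) ^ 2) < 1 ∧ ∀ l : Fin N', z (Fin.natAdd (2 * k) l) ∈ Set.Ioo (0:ℝ) 1} → Set.EqOn ρ'.integrand (fun z => c * (k.factorial : ℝ) * ∏ l, (z (Fin.natAdd (2 * k) l)) ^ ((x' l : ℝ) - 1) * (1 - z (Fin.natAdd (2 * k) l)) ^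 ((y' l : ℝ) - 1)) ρ'.domain → ρ.value = ρ'.value → Literature.NumberTheory.Transcendental.KZ.of ρ - Literature.NumberTheory.Transcendental.KZ.of ρ' ∈ H) → ∀ ⦃n m : ℕ⦄ (r : Literature.NumberTheory.Transcendental.KZ.IntegralRep n) (r' : Literature.NumberTheory.Transcendental.KZ.IntegralRep m), r.IsRational → r'.IsRational → r.value = r'.value → Literature.NumberTheory.Transcendental.KZ.of r - Literature.NumberTheory.Transcendental.KZ.of r' ∈ H

/-- item stmt-KontsevichZagierPeriods-3743 · aside · rank 4 · open · by planner
why it might fail: Even for divisor classes the Gysin/tube chain on F_d×F_d ⊂ ℝ^8 must stay absolutely convergent at the points at infinity; if explicit isogenies are needed instead, Das's pairs have none in print.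
sources: Das2000, HuberWustholz2022, Deligne1982HodgeCycles, Aoki1987, KontsevichZagier2001
[crux] DIVISOR RANGE N+N' = 2 of GammaHodgeSector (shapes B·B = c·π and B = c·B'). Here the Deligne
class lives in H² of F_d × F_d and is a divisor class (Lefschetz (1,1)), i.e. an honest algebraic
correspondence between CM factors of J(F_d) (HuberWustholz2022: ℚ̄-linear relations of 1-periods are
isogeny-induced) — the first test of the ENGINE without André and without Λ:
Gysin/cup-with-cycle-class + sheet transfer suffice, and the motivated engine needs only the
cohomology CLASS, whereas the correspondence itself is in general inexplicit (Das2000: for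
non-standard Hodge-type pairs only the square follows from reflection/multiplication, so the isogeny
is outside the group ring of automorphisms). Instances: stmt-KontsevichZagierPeriods-0312
TriplicationAccessible (shared by Neg/ExpConservative/MultivaluedCoV), LowDimension's
LowdimDuplicationOneThird, Das's B(4/15,1/5) ∝ B(1/3,2/15). [difficulty: L] -/
@[route_item "route-KontsevichZagierPeriods-MotivatedMoves"]
def GammaHodgePairs : Prop :=
  ∀ (N N' k : ℕ), N + N' = 2 → ∀ (x y : Fin N → ℚ) (x' y' : Fin N' → ℚ) (c : ℝ), (∀ j, 0 < x j ∧ 0 < y j ∧ Int.fract (x j) ≠ 0 ∧ Int.fract (y j) ≠ 0) → (∀ l, 0 < x' l ∧ 0 < y' l ∧ Int.fract (x' l) ≠ 0 ∧ Int.fract (y' l) ≠ 0) → (∀ u : ℕ, 0 < u → (∀ j, Nat.Coprime u (x j).den ∧ Nat.Coprime u (y j).den) → (∀ l, Nat.Coprime u (x' l).den ∧ Nat.Coprime u (y' l).den) → ((∑ j, (Int.fract ((u : ℚ) * x j) + Int.fract ((u : ℚ) * y j) - Int.fract ((u : ℚ) * (x j + y j)))) - ∑ l, (Int.fract ((u :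 ℚ) * x' l) + Int.fract ((u : ℚ) * y' l) - Int.fract ((u : ℚ) * (x' l + y' l)))) = (k : ℚ)) → IsAlgebraic ℚ c → ∀ (r : Literature.NumberTheory.Transcendental.KZ.IntegralRep N) (r' : Literature.NumberTheory.Transcendental.KZ.IntegralRep (2 * k + N')), r.domain = {t | ∀ j, t j ∈ Set.Ioo (0:ℝ) 1} → Set.EqOn r.integrand (fun t => ∏ j, (t j) ^ ((x j : ℝ) - 1) * (1 - t j) ^ ((y j : ℝ) - 1)) r.domain → r'.domain = {z | (∑ i : Fin (2 * k), (z (Fin.castAdd N' i)) ^ 2) < 1 ∧ ∀ l : Fin N', z (Fin.natAdd (2 * k) l) ∈ Set.Ioo (0:ℝ) 1} → Set.EqOn r'.integrand (fun z => c * (k.factorial : ℝ) * ∏ l, (z (Fin.natAdd (2 * k) l)) ^ ((x' l : ℝ) - 1) * (1 - z (Fin.natAdd (2 * k) l)) ^ ((y' l : ℝ) - 1)) r'.domain → r.value = r'.value → Literature.NumberTheory.Transcendental.KZ.Equivalent r r'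

/-- item stmt-KontsevichZagierPeriods-14697 · aside · rank 7 · open · by planner
why it might fail: Refuter rattack-14697-0: for C⁰-boundary admissible cubes the coordinate split of Stokes has non-L¹ terms (rational 2-cube Y=t⁵/(t⁴+(s−½−t)²), ∫∫|Y_st|=∞), so band Newton–Leibniz needs a rectilinearisation theorem; one bad admissible chain kills the typed ∃ (C¹-to-the-boundary cubes survive).
sources: HuberMullerStachPeriodsIII2015, HuberMullerStachPeriodsI2015, KontsevichZagier2001, OhmotoShiota2017, BochnakCosteRoy1998, Spivak1965
[crux] CONSTRUCTION OF THE TRANSFER DATUM (the existence statement kept separate from the interface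
at open — 'never smuggle existence into the interface' —, typable since defn-PureNaivePeriodMap
landed; it de-vacuifies MotivatedTransfer and AbelianHodgeDividend, refuter rattack-3891-0: 'pair
with Nonempty(PureNaivePeriodMap)'). For every number field K with σ : K →+* ℂ there is a
PureNaivePeriodMap K σ that is (i) PULLBACK-NORMALISED: on an admissible cube φ, Φ(ω, φ) ≡
([(0,1)^i, Re (φ*ω^σ)(∂₁φ,…,∂ᵢφ)], [(0,1)^i, Im …]) mod relations₂ whenever these canonical
Kontsevich–Zagier representations exist (always: support CanonicalNaiveRep), and (ii) satisfies
STOKES: Φ(dα, c) ≡ Φ(α, ∂c) mod relations₂ for every polynomial form α and every admissible cubical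
chain c (this implies the interface axioms `exact` and, with `vanish`, `boundary`; the engine's
tube/residue steps need it on NON-closed chains). With (i) the remaining axioms are single moves —
add_form = integrand additivity, smul_form = product with constant representations, eval =
definition of the value, vanish = zero integrand, reparam = one change of variables with |det h′|
(orientation-preserving h), mul = the Fubini product -/
@[route_item "route-KontsevichZagierPeriods-MotivatedMoves"]
def NaivePeriodMapExists : Prop :=
  ∀ (K : Type) [Field K] [NumberField K] (σ : K →+* ℂ), ∃ P : Literature.NumberTheory.Transcendental.PureNaivePeriodMap K σ, (∀ (N i : ℕ) (ω : Literature.AlgebraicGeometry.Motives.AffineDeRham.PolyForm K N i) (φ : Literature.NumberTheory.Transcendental.NaivePeriods.SingularCube N i), φ.IsAdmissible → ∀ (r₁ r₂ : Literature.NumberTheory.Transcendental.KZ.IntegralRep i), r₁.domain = Literature.NumberTheory.Transcendental.NaivePeriods.openUnitCube i → r₁.integrand = (fun t => (Literature.NumberTheory.Transcendental.NaivePeriods.SingularCube.integrand σ ω φ t).re) → r₂.domain = Literature.NumberTheory.Transcendental.NaivePeriods.openUnitCube i → r₂.integrand = (fun t => (Literature.NumberTheory.Transcendental.NaivePeriods.SingularCube.integrand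 σ ω φ t).im) → P.Φ ω φ - (Literature.NumberTheory.Transcendental.KZ.of r₁, Literature.NumberTheory.Transcendental.KZ.of r₂) ∈ Literature.NumberTheory.Transcendental.KZ.relations₂) ∧ (∀ (N i : ℕ) (α : Literature.AlgebraicGeometry.Motives.AffineDeRham.PolyForm K N i) (c : Literature.NumberTheory.Transcendental.NaivePeriods.CubicalChain N (i + 1)), c.IsAdmissibleIn Set.univ → P.onChain (Literature.AlgebraicGeometry.Motives.AffineDeRham.extDeriv α) c - P.onChain α (Literature.NumberTheory.Transcendental.NaivePeriods.CubicalChain.boundary c) ∈ Literature.NumberTheory.Transcendental.KZ.relations₂)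

/-- item stmt-KontsevichZagierPeriods-14698 · support · rank 9 · open · by planner
sources: HuberMullerStachPeriodsI2015, BochnakCosteRoy1998, Federer1969, KontsevichZagier2001
[support] CANONICAL NAIVE REPRESENTATIONS EXIST. For a number field K ⊂ ℂ (σ), a polynomial i-form ω
on 𝔸ᴺ_K and an ADMISSIBLE singular i-cube φ in ℂᴺ (ℚ-semialgebraic in real coordinates, continuous
on [0,1]^i, C^∞ on (0,1)^i, faces admissible), the real and imaginary parts of the pulled-back top
coefficient t ↦ ω^σ(φ t)(∂₁φ(t), …, ∂ᵢφ(t)) (= NaivePeriods.SingularCube.integrand σ ω φ) are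
ℚ-semialgebraic functions on the open cube (first derivatives of a semialgebraic C^∞ map are
semialgebraic; the coefficients σ(·) are complex algebraic numbers) and absolutely integrable on it
(ω^σ∘φ is bounded; by alternation the integrand is a combination of i×i minors of D(realCoords ∘ φ),
each bounded by the i-Jacobian J_iφ, and ∫ J_iφ = ∫ N(φ, y) dH^i(y) < ∞ by the area formula: the
bounded semialgebraic image has finite i-dimensional Hausdorff measure and a.e.-bounded multiplicity
by Hardt triviality) — i.e. KZ.IntegralRep's of dimension i with domain openUnitCube i and exactly
these integrands exist. De-vacuifies the normalisation clause of NaivePeriodMapExists and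
MotivatedTransfer; it is also the absolute-convergence half of 'naive periods are Kontsevich–Zagier
periods' (HuberMullerStach -/
@[route_item "route-KontsevichZagierPeriods-MotivatedMoves"]
def CanonicalNaiveRep : Prop :=
  ∀ (K : Type) [Field K] [NumberField K] (σ : K →+* ℂ) (N i : ℕ) (ω : Literature.AlgebraicGeometry.Motives.AffineDeRham.PolyForm K N i) (φ : Literature.NumberTheory.Transcendental.NaivePeriods.SingularCube N i), φ.IsAdmissible → ∃ r₁ r₂ : Literature.NumberTheory.Transcendental.KZ.IntegralRep i, r₁.domain = Literature.NumberTheory.Transcendental.NaivePeriods.openUnitCube i ∧ r₁.integrand = (fun t => (Literature.NumberTheory.Transcendental.NaivePeriods.SingularCube.integrand σ ω φ t).re) ∧ r₂.domain = Literature.NumberTheory.Transcendental.NaivePeriods.openUnitCube i ∧ r₂.integrand = (fun t => (Literature.NumberTheory.Transcendental.NaivePeriods.SingularCube.integrand σ ω φ t).im)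

-- item stmt-KontsevichZagierPeriods-14919 · support · rank 9 · open · by planner — informal only, no Lean statement yet:
--   [support] ANDRÉ DIVIDEND (informal; re-filed 2026-08-16 rev 8 as SUPPORT — it was crux rank 5,
--   stmt-KontsevichZagierPeriods-3892, auto-promoted on a false-positive token and judged near-glue by
--   refuter rattack-3892-0, whose ATTACK.md on stmt-3892 is the record; re-badge crux on typing only if
--   the bookkeeping below proves non-routine). CLAIM: MotivatedTransfer (crux #3, rev-5 frame: the
--   pullback-normalised Stokes period map Φ of NaivePeriodMapExists on Jouanolou affine models, values
--   in KZ.FormalRep² modulo KZ.relations₂) ∧ (h062 : André 1996 Thm 0.6.2 'tout cycle de Hodge sur une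
--   variété abéli

/-- item stmt-KontsevichZagierPeriods-3744 · support · rank 9 · closed · proved by Summit.KontsevichZagierPeriods.MotivatedMoves.lefschetzInversionFree_proof @ d68f8322bb4a (prover) · by planner
sources: Andre1996Motifs, Kleiman1968, KontsevichZagier2001
[support] LEFSCHETZ INVERSION IS FREE (card item (c)): in the non-unital ring FormalRep with
two-sided ideal `relations` (KZProductIdeal: mul_mem_relations_left/right_holds), if Ainv is a left
inverse of A modulo relations (acting on every x) and the entrywise Lefschetz identities A·P ≡ Q·B
hold modulo relations, then P ≡ Ainv·Q·B entrywise — no inverse of the Betti matrix, no algebraicity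
of Λ. Left-ideal property + distributivity; ~20 lines. [difficulty: provable-now] -/
@[route_item "route-KontsevichZagierPeriods-MotivatedMoves"]
def LefschetzInversionFree : Prop :=
  ∀ (d : ℕ) (A Ainv P Q B : Matrix (Fin d) (Fin d) Literature.NumberTheory.Transcendental.KZ.FormalRep), (∀ (i j : Fin d) (x : Literature.NumberTheory.Transcendental.KZ.FormalRep), (∑ l, Ainv i l * (A l j * x)) - (if i = j then x else 0) ∈ Literature.NumberTheory.Transcendental.KZ.relations) → (∀ i j, (∑ m, A i m * P m j) - (∑ m, Q i m * B m j) ∈ Literature.NumberTheory.Transcendental.KZ.relations) → ∀ i j, P i j - (∑ l, ∑ m, Ainv i l * (Q l m * B m j)) ∈ Literature.NumberTheory.Transcendental.KZ.relations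

-- `LefschetzInversionFree` holds: proved by `Summit.KontsevichZagierPeriods.MotivatedMoves.lefschetzInversionFree_proof` @ d68f8322bb4a (its module imports this route file, so no `_holds` link can be stated here).

/-- item stmt-KontsevichZagierPeriods-3745 · support · rank 9 · closed · proved by Summit.KontsevichZagierPeriods.MotivatedMoves.constantMatrixUnit_proof @ 56336c2015ec (prover) · by planner
sources: KontsevichZagier2001, HuberMullerStachPeriods2017
[support] Discharges LefschetzInversionFree's unit hypothesis for matrices of ALGEBRAIC CONSTANTS:
if ainv·a = 1 in Mat_d(ℝ) and R, Rinv are the matrices of 0-dimensional constant representations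
[pt, a_lj], [pt, ainv_il] (their existence as IntegralRep 0 forces the entries to be real
algebraic), then Σ_l [Rinv_il]·([R_lj]·x) ≡ δ_ij·x modulo relations for every x ∈ FormalRep:
integrand additivity on the common domain pt×pt×σ, the zero-integrand relation, the reindexing
change of variables Fin (0+(0+n)) ≃ Fin n (`KZ.of_sub_of_reindex_mem_relations`), and additivity in
x from generators. This is the 'ℚ̄∩ℝ acts invertibly on P_KZ' plumbing (cf. card
integral-domain-roots-of-identities L0). [difficulty: provable-now] -/
@[route_item "route-KontsevichZagierPeriods-MotivatedMoves"]
def ConstantMatrixUnit : Prop :=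
  ∀ (d : ℕ) (a ainv : Matrix (Fin d) (Fin d) ℝ), ainv * a = 1 → ∀ (R Rinv : Matrix (Fin d) (Fin d) (Literature.NumberTheory.Transcendental.KZ.IntegralRep 0)), (∀ i j, (R i j).domain = Set.univ ∧ (R i j).integrand = fun _ => a i j) → (∀ i j, (Rinv i j).domain = Set.univ ∧ (Rinv i j).integrand = fun _ => ainv i j) → ∀ (i j : Fin d) (x : Literature.NumberTheory.Transcendental.KZ.FormalRep), (∑ l, Literature.NumberTheory.Transcendental.KZ.of (Rinv i l) * (Literature.NumberTheory.Transcendental.KZ.of (R l j) * x)) - (if i = j then x else 0) ∈ Literature.NumberTheory.Transcendental.KZ.relations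

-- `ConstantMatrixUnit` holds: proved by `Summit.KontsevichZagierPeriods.MotivatedMoves.constantMatrixUnit_proof` @ 56336c2015ec (its module imports this route file, so no `_holds` link can be stated here).

-- earlier Assembly (stmt-KontsevichZagierPeriods-10444, replaced 2026-08-16T03:13:12Z -> stmt-KontsevichZagierPeriods-14266): retired by None — GammaHodgeSector → GammaSectorComplete → KontsevichZagierPeriods
-- earlier Assembly (stmt-KontsevichZagierPeriods-14266, replaced 2026-08-16T03:24:44Z -> stmt-KontsevichZagierPeriods-14232): retired by None — GammaHodgeSector → CompleteModuloGammaSector → KontsevichZagierPeriods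
-- earlier Assembly (stmt-KontsevichZagierPeriods-3747, replaced 2026-08-15T16:15:33Z -> stmt-KontsevichZagierPeriods-10444): retired by None — GammaHodgeSector → SummitOffGammaSector → KontsevichZagierPeriods
/-- item stmt-KontsevichZagierPeriods-14232 · assembly · rank 1 · closed · proved by Summit.KontsevichZagierPeriods.Theorems.TerasomaMultiplicationAssembly.assembly_proof @ 7316e893a8d1 (prover) · by planner
sources: KontsevichZagier2001
[assembly] GammaHodgeSector → CompleteModGammaSector → the sub-problem statement: the Γ-Hodge sector
(every Deligne–Koblitz–Ogus pair difference lies in relations) plus Conjecture 1 for the Γ-enlarged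
calculus (every relations-containing subgroup holding those differences holds all rational
equal-value differences) give Conjecture 1; the deciding theorem `closes` proves exactly this
implication (rev 7 replaces the rev-1 GammaHodgeSector → GammaSectorComplete → summit). -/
@[route_item "route-KontsevichZagierPeriods-MotivatedMoves"]
def Assembly : Prop :=
  GammaHodgeSector → CompleteModGammaSector → KontsevichZagierPeriods

-- `Assembly` holds: proved by `Summit.KontsevichZagierPeriods.Theorems.TerasomaMultiplicationAssembly.assembly_proof` @ 7316e893a8d1 (its module imports this route file, so no `_holds` link can be stated here).

/-! D-0027 §2.1 — DECIDING THEOREM (planner-authored via `route open/edit --closes-file`; by planner-rbadge-KontsevichZagierPeriods-Motivat-845f87ee-g3-0 2026-08-16T06:45:25Z):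
its hypotheses are this route's items and its conclusion the sub-problem Statement (glue_lint), and it elaborates with this file. -/

@[closes "route-KontsevichZagierPeriods-MotivatedMoves"] theorem closes (h₁ : GammaHodgeSector) (h₂ : CompleteModGammaSector) : KontsevichZagierPeriods := by
  intro n m r r' hr hr' hv
  exact h₂ _ le_rfl (fun N N' k x y x' y' c hx hx' hu hc ρ ρ' hd hi hd' hi' hval =>
    h₁ N N' k x y x' y' c hx hx' hu hc ρ ρ' hd hi hd' hi' hval) r r' hr hr' hv

end Summit.KontsevichZagierPeriods.KontsevichZagierPeriods.Theses.MotivatedMoves
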